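import Literature.Topology.FourManifolds.BallGluingCharts
import Literature.Topology.FourManifolds.RegularLevelSet
import HarnessLib

/-!
# A local left inverse of the track of an isotopy (inverse function theorem in immersion charts)

Infrastructure for the isotopy extension theorem (Hirsch, *Differential Topology* (1976), Ch. 8
§1, Thm. 1.3; fact seat `provefact-Literature.isSmoothlyIsotopic_iff_isAmbientIsotopic`).  In
Hirsch's proof the velocity field of the track `F̂(V × I)` is extended to a neighbourhood "by
means of a tubular neighborhood of `F̂(V × I)`" (p. 180).  We replace the tubular neighbourhood
by the following local statement, which is all that is needed for a partition-of-unity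
extension: **about every point of the track lying over an interior point of `M` there is a
smooth local left inverse** `L : ℝ × N → ℝ × M` **of the track map** `(t, x) ↦ (t, F_t x)`
(`Literature.Topology.FourManifolds.SmoothIsotopy.exists_localLeftInverse_track`; the track map
is written out as `q ↦ (q.1, F_{q.1} q.2)` here, so that this file does not depend on
`IsotopyTrack.lean`, where it is `SmoothIsotopy.track`).

Construction (the standard proof that an injective immersion is locally a slice, Lee,
*Introduction to Smooth Manifolds* (2013), Thm. 4.12 / 5.8, run with a time parameter): at an
interior point `x₀` the stage `F_{t₀}` is an immersion, so Mathlib's `Manifold.IsImmersionAt`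
provides charts `φ` of `M` at `x₀`, `ψ` of `N` at `F_{t₀} x₀` and a splitting
`e : EM × F' ≃L EN` with `ψ ∘ F_{t₀} ∘ φ⁻¹ = e ∘ (·, 0)`.  The map
`K (s, u, w) = (s, ψ (F_s (φ⁻¹ u)) + e (0, w))` on `ℝ × EM × F'` then has the invertible
derivative `(σ, μ, ω) ↦ (σ, e (μ, ω) + σ • v)` at `(t₀, φ x₀, 0)` (`v` the time derivative; a
`ContinuousLinearEquiv.skewProd`), so
by the inverse function theorem (the tree's packaged form
`Literature.Topology.FourManifolds.exists_openPartialHomeomorph_contDiffOn_symm`) it is a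
diffeomorphism near that point, and `L = (id × φ⁻¹) ∘ pr ∘ K⁻¹ ∘ (id × ψ)` is the sought left
inverse, since `K (s, φ x, 0) = (s, ψ (F_s x))`.

Relation to `IsotopyTrackInverse.lean` (landed the same day for the fact seat of Milnor's
Thm. 5.8, `provefact-…Cobord-0bdd435f08`): its
`Literature.Topology.FourManifolds.exists_contMDiffOn_leftInverse_track` is the same step of
the same proof under the hypotheses *boundaryless model* `I.Boundaryless`, `CompleteSpace EM`,
`M` compact, `N` Hausdorff, with the stronger conclusion `Λ (t, F_t x) = x` for **all** `x`
with `(t, F_t x)` in the neighbourhood (values in `M`).  The present theorem asks only that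
`x₀` be an **interior point** of `M` (the model `I` may have boundary or corners, `M` need not
be compact; finite-dimensional target model), at the price of a conclusion local in `x`
(identity on a neighbourhood `W` of `(t₀, x₀)`; compactness re-enters downstream through
`SmoothIsotopy.exists_isOpen_preimage_track_subset`, `IsotopyTrack.lean`).  This generality —
`BoundarylessManifold I M` rather than `I.Boundaryless` — is what the diffeomorphism case
`Diffeomorph.isIsotopic_iff_isAmbientIsotopic` of `Isotopy.lean` needs (it assumes only
`BoundarylessManifold J N` on `N`, which is also the source there), and what the facts
`isAmbientIsotopic_of_isSmoothlyIsotopic` / `isSmoothlyIsotopic_iff_isAmbientIsotopic` need for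
sources that are `BoundarylessManifold`s (planned file `IsotopyExtensionBoundarylessManifold.lean`
of this seat, to be landed after the present one; sources *with* boundary points are not covered
by either line, see below).  Use the `IsotopyTrackInverse` theorem when the models are
boundaryless and a global-in-`x` inverse is wanted; use this one at interior points of general
models.

Interior points are seen in every chart of the maximal atlas: this is the tree's
`Literature.Topology.FourManifolds.mem_interior_extend_target_of_mem_maximalAtlas`
(`BallGluingCharts.lean`), used here to place the immersion chart of the stage in the interior.

Everything in this file is proved; no named facts are introduced.

What is NOT here: track points `(t₀, F_{t₀} x₀)` over a **boundary point** `x₀` of `M` (the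
hypothesis `I.IsInteriorPoint x₀` of `exists_localLeftInverse_track` is genuinely used: the
chart expression of the isotopy is `C^∞` only *within* `ℝ × range I`, and over a boundary
point it would first have to be extended across the boundary of the model, jointly in time —
Seeley's theorem for half-space models; this is exactly what an isotopy extension theorem for
sources with boundary would additionally need).

## References

* M. W. Hirsch, *Differential Topology*, GTM 33, Springer (1976), Ch. 8 §1, Thm. 1.3 and its
  proof, p. 180. [HirschDT1976]
* J. M. Lee, *Introduction to Smooth Manifolds*, 2nd ed., GTM 218 (2013), Thm. 4.12 (rank
  theorem), Thm. 5.8 (local slice criterion). [LeeSmoothManifolds2013]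
-/

open scoped Manifold ContDiff Topology
open Set Function Filter

noncomputable section

namespace Literature.Topology.FourManifolds


namespace SmoothIsotopy

variable {EM HM EN HN : Type*} [NormedAddCommGroup EM] [NormedSpace ℝ EM] [TopologicalSpace HM]
  [NormedAddCommGroup EN] [NormedSpace ℝ EN] [TopologicalSpace HN]
  {I : ModelWithCorners ℝ EM HM} {J : ModelWithCorners ℝ EN HN}
  {M : Type*} [TopologicalSpace M] [ChartedSpace HM M]
  {N : Type*} [TopologicalSpace N] [ChartedSpace HN N]
  {f g : M → N} (F : SmoothIsotopy I J f g)
  (φ : OpenPartialHomeomorph M HM) (ψ : OpenPartialHomeomorph N HN)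

/-! ### The track read in charts -/

/-- The isotopy read in the charts `φ` (on `M`, extended by `I`) and `ψ` (on `N`, extended by
`J`), as a function of time and of the chart coordinate: `(s, u) ↦ ψ (F_s (φ⁻¹ u))`. [folklore] -/
def trackChart (p : ℝ × EM) : EN :=
  ψ.extend J (F.toFun p.1 ((φ.extend I).symm p.2))

/-- The domain on which `trackChart` is used: chart coordinates in the interior of the target
of `φ`, mapped by the stage into the domain of `ψ`. [folklore] -/
def trackChartDom : Set (ℝ × EM) :=
  {p | p.2 ∈ interior (φ.extend I).target ∧ F.toFun p.1 ((φ.extend I).symm p.2) ∈ ψ.source}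

/-- Unfolding `trackChart`. [folklore] -/
theorem trackChart_apply (p : ℝ × EM) :
    F.trackChart φ ψ p = ψ.extend J (F.toFun p.1 ((φ.extend I).symm p.2)) := rfl

/-- Membership in `trackChartDom`. [folklore] -/
theorem mem_trackChartDom {p : ℝ × EM} :
    p ∈ F.trackChartDom φ ψ ↔
      p.2 ∈ interior (φ.extend I).target ∧ F.toFun p.1 ((φ.extend I).symm p.2) ∈ ψ.source :=
  Iff.rfl

/-- The domain `trackChartDom` is open. [folklore] -/
theorem isOpen_trackChartDom : IsOpen (F.trackChartDom φ ψ) := by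
  have hc : ContinuousOn (fun p : ℝ × EM => F.toFun p.1 ((φ.extend I).symm p.2))
      ((univ : Set ℝ) ×ˢ interior (φ.extend I).target) := by
    refine F.contMDiff.continuous.comp_continuousOn (continuousOn_fst.prodMk ?_)
    exact (φ.continuousOn_extend_symm.mono interior_subset).comp continuousOn_snd
      fun p hp => hp.2
  have h := hc.isOpen_inter_preimage (isOpen_univ.prod isOpen_interior) ψ.open_source
  convert h using 1
  ext p
  simp only [mem_trackChartDom, mem_inter_iff, mem_prod, mem_univ, true_and, mem_preimage]

/-- `trackChart` is `C^∞` on `trackChartDom` when `φ`, `ψ` belong to the maximal atlases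
(composition of the smooth inverse extended chart, the isotopy and the extended chart).
[folklore] -/
theorem contDiffOn_trackChart (hφ : φ ∈ IsManifold.maximalAtlas I ∞ M)
    (hψ : ψ ∈ IsManifold.maximalAtlas J ∞ N) :
    ContDiffOn ℝ ∞ (F.trackChart φ ψ) (F.trackChartDom φ ψ) := by
  have h1 : ContMDiffOn 𝓘(ℝ, ℝ × EM) (𝓘(ℝ, ℝ).prod I) ∞
      (fun p : ℝ × EM => ((p.1, (φ.extend I).symm p.2) : ℝ × M)) (F.trackChartDom φ ψ) := by
    refine (contDiff_fst.contMDiff.contMDiffOn).prodMk ?_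
    refine (contMDiffOn_extend_symm hφ).comp contDiff_snd.contMDiff.contMDiffOn fun p hp => ?_
    rw [← φ.extend_target']
    show p.2 ∈ (φ.extend I).target
    exact interior_subset hp.1
  have h2 : ContMDiffOn 𝓘(ℝ, ℝ × EM) J ∞
      (fun p : ℝ × EM => F.toFun p.1 ((φ.extend I).symm p.2)) (F.trackChartDom φ ψ) :=
    F.contMDiff.comp_contMDiffOn h1
  have h3 : ContMDiffOn 𝓘(ℝ, ℝ × EM) 𝓘(ℝ, EN) ∞ (F.trackChart φ ψ) (F.trackChartDom φ ψ) :=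
    (ψ.contMDiffOn_extend hψ).comp h2 fun p hp => hp.2
  exact contMDiffOn_iff_contDiffOn.1 h3

/-! ### The derivative of the track in immersion charts -/

section Deriv

variable {φ ψ} {F' : Type*} [NormedAddCommGroup F'] [NormedSpace ℝ F']
  {e : (EM × F') ≃L[ℝ] EN} {t₀ : ℝ} {x₀ : M}

/-- In immersion charts for the stage `F_{t₀}` (so that `ψ ∘ F_{t₀} ∘ φ⁻¹ = e ∘ (·, 0)` on the
target of `φ`), at a point of the interior of that target, the partial derivative of
`trackChart` in the chart coordinate is `e ∘ (·, 0)`. [folklore] -/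
theorem hasFDerivAt_trackChart_slice
    (hwr : EqOn (ψ.extend J ∘ F.toFun t₀ ∘ (φ.extend I).symm) (e ∘ fun u => (u, (0 : F')))
      (φ.extend I).target)
    {u₀ : EM} (hu₀ : u₀ ∈ interior (φ.extend I).target) :
    HasFDerivAt (fun u : EM => F.trackChart φ ψ (t₀, u))
      ((e : (EM × F') →L[ℝ] EN).comp (ContinuousLinearMap.inl ℝ EM F')) u₀ := by
  have hlin : HasFDerivAt (fun u : EM => e (u, (0 : F')))
      ((e : (EM × F') →L[ℝ] EN).comp (ContinuousLinearMap.inl ℝ EM F')) u₀ :=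
    ((e : (EM × F') →L[ℝ] EN).hasFDerivAt).comp u₀ (ContinuousLinearMap.inl ℝ EM F').hasFDerivAt
  refine hlin.congr_of_eventuallyEq ?_
  filter_upwards [isOpen_interior.mem_nhds hu₀] with u hu
  exact hwr (interior_subset hu)

/-- The derivative of `trackChart` at `(t₀, u₀)` splits as
`(σ, μ) ↦ σ • v + e (μ, 0)`, where `v` is the time derivative. [folklore] -/
theorem fderiv_trackChart_apply (hφ : φ ∈ IsManifold.maximalAtlas I ∞ M)
    (hψ : ψ ∈ IsManifold.maximalAtlas J ∞ N)
    (hwr : EqOn (ψ.extend J ∘ F.toFun t₀ ∘ (φ.extend I).symm) (e ∘ fun u => (u, (0 : F')))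
      (φ.extend I).target)
    {u₀ : EM} (h₀ : (t₀, u₀) ∈ F.trackChartDom φ ψ) (σ : ℝ) (μ : EM) :
    fderiv ℝ (F.trackChart φ ψ) (t₀, u₀) (σ, μ) =
      σ • fderiv ℝ (F.trackChart φ ψ) (t₀, u₀) ((1 : ℝ), (0 : EM)) + e (μ, (0 : F')) := by
  set D := fderiv ℝ (F.trackChart φ ψ) (t₀, u₀) with hD
  have hdiff : DifferentiableAt ℝ (F.trackChart φ ψ) (t₀, u₀) :=
    ((F.contDiffOn_trackChart φ ψ hφ hψ).differentiableOn (by simp)).differentiableAt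
      ((F.isOpen_trackChartDom φ ψ).mem_nhds h₀)
  -- the partial derivative in `u` computed two ways
  have hA : HasFDerivAt (fun u : EM => F.trackChart φ ψ (t₀, u))
      (D.comp (ContinuousLinearMap.inr ℝ ℝ EM)) u₀ := by
    have h := hdiff.hasFDerivAt.comp u₀ (hasFDerivAt_prodMk_right (𝕜 := ℝ) t₀ u₀)
    exact h
  have hB := F.hasFDerivAt_trackChart_slice (e := e) hwr h₀.1
  have hAB : D.comp (ContinuousLinearMap.inr ℝ ℝ EM) =
      (e : (EM × F') →L[ℝ] EN).comp (ContinuousLinearMap.inl ℝ EM F') := hA.unique hB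
  have hμ : D ((0 : ℝ), μ) = e (μ, (0 : F')) := by
    have := congrArg (fun T : EM →L[ℝ] EN => T μ) hAB
    simpa using this
  have hdecomp : ((σ, μ) : ℝ × EM) = σ • ((1 : ℝ), (0 : EM)) + ((0 : ℝ), μ) := by
    ext <;> simp
  rw [hdecomp, map_add, map_smul, hμ]

end Deriv

/-! ### The thickened track in charts and its local inverse -/

section Thick

variable {F' : Type*} [NormedAddCommGroup F'] [NormedSpace ℝ F'] (e : (EM × F') ≃L[ℝ] EN)

/-- The **thickened track in charts**: `K (s, (u, w)) = (s, ψ (F_s (φ⁻¹ u)) + e (0, w))` on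
`ℝ × (EM × F')`, an equidimensional map extending the chart expression of the track
`(s, u) ↦ (s, ψ (F_s (φ⁻¹ u)))` in the normal directions `e (0 × F')`. [folklore] -/
def thickTrackChart (p : ℝ × (EM × F')) : ℝ × EN :=
  (p.1, F.trackChart φ ψ (p.1, p.2.1) + e ((0 : EM), p.2.2))

/-- Unfolding `thickTrackChart`. [folklore] -/
@[simp]
theorem thickTrackChart_apply (p : ℝ × (EM × F')) :
    F.thickTrackChart φ ψ e p = (p.1, F.trackChart φ ψ (p.1, p.2.1) + e ((0 : EM), p.2.2)) := rfl

/-- The domain of the thickened track in charts. [folklore] -/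
def thickTrackChartDom : Set (ℝ × (EM × F')) :=
  {p | (p.1, p.2.1) ∈ F.trackChartDom φ ψ}

omit [NormedSpace ℝ F'] in
/-- The domain of the thickened track is open. [folklore] -/
theorem isOpen_thickTrackChartDom : IsOpen (F.thickTrackChartDom φ ψ (F' := F')) :=
  (F.isOpen_trackChartDom φ ψ).preimage (continuous_fst.prodMk (continuous_fst.comp continuous_snd))

/-- The thickened track is `C^∞` on its domain. [folklore] -/
theorem contDiffOn_thickTrackChart (hφ : φ ∈ IsManifold.maximalAtlas I ∞ M)
    (hψ : ψ ∈ IsManifold.maximalAtlas J ∞ N) :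
    ContDiffOn ℝ ∞ (F.thickTrackChart φ ψ e) (F.thickTrackChartDom φ ψ) := by
  refine contDiffOn_fst.prodMk (ContDiffOn.add ?_ ?_)
  · have hπ : ContDiff ℝ ∞ (fun p : ℝ × (EM × F') => ((p.1, p.2.1) : ℝ × EM)) :=
      contDiff_fst.prodMk (contDiff_fst.comp contDiff_snd)
    exact (F.contDiffOn_trackChart φ ψ hφ hψ).comp hπ.contDiffOn fun p hp => hp
  · exact ((e : (EM × F') →L[ℝ] EN).contDiff.comp
      ((contDiff_const (c := (0 : EM))).prodMk (contDiff_snd.comp contDiff_snd))).contDiffOn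

/-- **The derivative of the thickened track at the base point is a shear isomorphism**: the
`ContinuousLinearEquiv.skewProd` `(σ, (μ, w)) ↦ (σ, e (μ, w) + σ • v)` over the splitting `e`,
with `v = ∂/∂s` of the chart expression (in immersion charts for the stage `F_{t₀}`; cf. the
shear of `IsotopyTrackInverse.lean`). [folklore] -/
theorem hasFDerivAt_thickTrackChart (hφ : φ ∈ IsManifold.maximalAtlas I ∞ M)
    (hψ : ψ ∈ IsManifold.maximalAtlas J ∞ N) {t₀ : ℝ}
    (hwr : EqOn (ψ.extend J ∘ F.toFun t₀ ∘ (φ.extend I).symm) (e ∘ fun u => (u, (0 : F')))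
      (φ.extend I).target)
    {u₀ : EM} (h₀ : (t₀, u₀) ∈ F.trackChartDom φ ψ) :
    HasFDerivAt (F.thickTrackChart φ ψ e)
      (((ContinuousLinearEquiv.refl ℝ ℝ).skewProd e ((1 : ℝ →L[ℝ] ℝ).smulRight
        (fderiv ℝ (F.trackChart φ ψ) (t₀, u₀) ((1 : ℝ), (0 : EM)))) :
        (ℝ × (EM × F')) →L[ℝ] (ℝ × EN))) (t₀, (u₀, (0 : F'))) := by
  set D := fderiv ℝ (F.trackChart φ ψ) (t₀, u₀) with hD
  have hdiff : DifferentiableAt ℝ (F.trackChart φ ψ) (t₀, u₀) :=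
    ((F.contDiffOn_trackChart φ ψ hφ hψ).differentiableOn (by simp)).differentiableAt
      ((F.isOpen_trackChartDom φ ψ).mem_nhds h₀)
  -- the linear map `π (s, (u, w)) = (s, u)`
  set π : (ℝ × (EM × F')) →L[ℝ] (ℝ × EM) :=
    (ContinuousLinearMap.fst ℝ ℝ (EM × F')).prod
      ((ContinuousLinearMap.fst ℝ EM F').comp (ContinuousLinearMap.snd ℝ ℝ (EM × F'))) with hπ
  have hk : HasFDerivAt (fun p : ℝ × (EM × F') => F.trackChart φ ψ (p.1, p.2.1)) (D.comp π)
      (t₀, (u₀, (0 : F'))) := by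
    have h := hdiff.hasFDerivAt.comp (t₀, (u₀, (0 : F'))) π.hasFDerivAt
    exact h
  -- the linear part `w ↦ e (0, w)`
  set ν : (ℝ × (EM × F')) →L[ℝ] EN :=
    (e : (EM × F') →L[ℝ] EN).comp ((ContinuousLinearMap.inr ℝ EM F').comp
      ((ContinuousLinearMap.snd ℝ EM F').comp (ContinuousLinearMap.snd ℝ ℝ (EM × F')))) with hν
  have hn : HasFDerivAt (fun p : ℝ × (EM × F') => e ((0 : EM), p.2.2)) ν (t₀, (u₀, (0 : F'))) :=
    ν.hasFDerivAt
  have hK : HasFDerivAt (F.thickTrackChart φ ψ e)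
      ((ContinuousLinearMap.fst ℝ ℝ (EM × F')).prod (D.comp π + ν)) (t₀, (u₀, (0 : F'))) :=
    (ContinuousLinearMap.fst ℝ ℝ (EM × F')).hasFDerivAt.prodMk (hk.add hn)
  refine hK.congr_fderiv ?_
  apply ContinuousLinearMap.ext
  rintro ⟨σ, μ, w⟩
  have hsplit := F.fderiv_trackChart_apply (e := e) hφ hψ hwr h₀ σ μ
  rw [← hD] at hsplit
  have he : e (μ, w) = e (μ, (0 : F')) + e ((0 : EM), w) := by
    rw [← map_add, Prod.mk_add_mk, add_zero, zero_add]
  simp only [hπ, hν, ContinuousLinearMap.prod_apply, add_apply,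
    ContinuousLinearMap.comp_apply, ContinuousLinearMap.coe_fst', ContinuousLinearMap.coe_snd',
    ContinuousLinearMap.inr_apply, ContinuousLinearEquiv.coe_coe,
    ContinuousLinearEquiv.skewProd_apply, ContinuousLinearEquiv.refl_apply,
    ContinuousLinearMap.smulRight_apply, hsplit, he]
  refine Prod.ext rfl ?_
  change σ • D ((1 : ℝ), (0 : EM)) + e (μ, (0 : F')) + e ((0 : EM), w) =
    e (μ, (0 : F')) + e ((0 : EM), w) + ((1 : ℝ →L[ℝ] ℝ) σ) • D ((1 : ℝ), (0 : EM))
  rw [one_apply_eq_self]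
  abel

end Thick

/-! ### The local left inverse -/

/-- **Local left inverse of the track of an isotopy.**  Let `F` be a smooth isotopy of maps
`M → N` (`C^∞` manifolds, `N` over a finite-dimensional model space) and `x₀` an interior point
of `M`.  Then for every time `t₀` there are an open neighbourhood `U` of the track point
`(t₀, F_{t₀} x₀)` in `ℝ × N`, a map `L : ℝ × N → ℝ × M` which is `C^∞` on `U`, and an open
neighbourhood `W` of `(t₀, x₀)` in `ℝ × M` whose track lies in `U`, such that
`L (t, F_t x) = (t, x)` for all `(t, x) ∈ W`.  (Hirsch (1976), Ch. 8 §1, proof of Thm. 1.3, where a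
tubular neighbourhood of the track is used instead; here: the inverse function theorem applied
to the thickened track `thickTrackChart` in immersion charts of the stage `F_{t₀}`.)
Compare `Literature.Topology.FourManifolds.exists_contMDiffOn_leftInverse_track`
(`IsotopyTrackInverse.lean`): there the models are boundaryless (`I.Boundaryless`), `M` is
compact and the left inverse is `M`-valued and the identity for *all* `x` with `(t, F_t x)` in
the neighbourhood; here only `x₀` interior is assumed (general model with corners, no
compactness) and the identity holds on a neighbourhood `W` of `(t₀, x₀)` — the form needed for
sources that are `BoundarylessManifold`s but not over a boundaryless model (the planned
`IsotopyExtensionBoundarylessManifold.lean` of this seat).  The model space `EM` is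
finite-dimensional along with `EN` (through the splitting of the immersion charts).
[cite: HirschDT1976, Ch. 8 §1, proof of Thm. 1.3] -/
theorem exists_localLeftInverse_track [IsManifold I ∞ M] [FiniteDimensional ℝ EN] {x₀ : M}
    (hx₀ : I.IsInteriorPoint x₀) (t₀ : ℝ) :
    ∃ U : Set (ℝ × N), IsOpen U ∧ ((t₀, F.toFun t₀ x₀) : ℝ × N) ∈ U ∧
    ∃ L : ℝ × N → ℝ × M, ContMDiffOn (𝓘(ℝ, ℝ).prod J) (𝓘(ℝ, ℝ).prod I) ∞ L U ∧
    ∃ W : Set (ℝ × M), IsOpen W ∧ (t₀, x₀) ∈ W ∧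
      MapsTo (fun q : ℝ × M => ((q.1, F.toFun q.1 q.2) : ℝ × N)) W U ∧
      ∀ q ∈ W, L (q.1, F.toFun q.1 q.2) = q := by
  -- immersion charts for the stage `F_{t₀}` at `x₀`
  have himm : Manifold.IsImmersionAt I J ∞ (F.toFun t₀) x₀ :=
    (F.isSmoothEmbedding t₀).isImmersion.isImmersionAt x₀
  set φ := himm.domChart with hφ_def
  set ψ := himm.codChart with hψ_def
  set e := himm.equiv with he_def
  have hφ : φ ∈ IsManifold.maximalAtlas I ∞ M := himm.domChart_mem_maximalAtlas
  have hψ : ψ ∈ IsManifold.maximalAtlas J ∞ N := himm.codChart_mem_maximalAtlas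
  have hxφ : x₀ ∈ φ.source := himm.mem_domChart_source
  have hyψ : F.toFun t₀ x₀ ∈ ψ.source := himm.mem_codChart_source
  have hwr : EqOn (ψ.extend J ∘ F.toFun t₀ ∘ (φ.extend I).symm)
      (e ∘ fun u => (u, (0 : himm.complement))) (φ.extend I).target := himm.writtenInCharts
  -- finite dimension (through `e`) and completeness of the chart spaces
  have hfinF' : FiniteDimensional ℝ himm.complement :=
    Module.Finite.of_injective
      ((e : (EM × himm.complement) →L[ℝ] EN).toLinearMap.comp (LinearMap.inr ℝ EM himm.complement))
      (e.injective.comp LinearMap.inr_injective)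
  haveI : FiniteDimensional ℝ EM :=
    Module.Finite.of_injective
      ((e : (EM × himm.complement) →L[ℝ] EN).toLinearMap.comp (LinearMap.inl ℝ EM himm.complement))
      (e.injective.comp LinearMap.inl_injective)
  haveI : CompleteSpace EM := FiniteDimensional.complete ℝ EM
  haveI : CompleteSpace himm.complement := FiniteDimensional.complete ℝ himm.complement
  -- the base point in charts
  set u₀ : EM := φ.extend I x₀ with hu₀
  have hu₀int : u₀ ∈ interior (φ.extend I).target :=
    mem_interior_extend_target_of_mem_maximalAtlas (by simp) (IsManifold.chart_mem_maximalAtlas x₀)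
      hφ (mem_chart_source HM x₀) hxφ (I.isInteriorPoint_iff.1 hx₀)
  have hsymm₀ : (φ.extend I).symm u₀ = x₀ := φ.extend_left_inv hxφ
  have h₀ : (t₀, u₀) ∈ F.trackChartDom φ ψ := ⟨hu₀int, by rwa [hsymm₀]⟩
  have ha : (t₀, (u₀, (0 : himm.complement))) ∈ F.thickTrackChartDom φ ψ := h₀
  -- the inverse function theorem for the thickened track
  obtain ⟨G, hGK, haG, hGsrc, -, hGsymm⟩ :=
    exists_openPartialHomeomorph_contDiffOn_symm (F.isOpen_thickTrackChartDom φ ψ) ha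
      (m := ∞) (by simp) (F.contDiffOn_thickTrackChart φ ψ e hφ hψ) _
      (F.hasFDerivAt_thickTrackChart φ ψ e hφ hψ hwr h₀)
  -- value of the thickened track on the slice `w = 0`
  have hKslice : ∀ s : ℝ, ∀ x ∈ φ.source,
      F.thickTrackChart φ ψ e (s, (φ.extend I x, 0)) = (s, ψ.extend J (F.toFun s x)) := by
    intro s x hx
    rw [thickTrackChart_apply, trackChart_apply, φ.extend_left_inv hx]
    simp
  -- the neighbourhood `U` and the left inverse `L`
  set U : Set (ℝ × N) := {p | p.2 ∈ ψ.source ∧ (p.1, ψ.extend J p.2) ∈ G.target} with hU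
  set L : ℝ × N → ℝ × M := fun p =>
    ((G.symm (p.1, ψ.extend J p.2)).1, (φ.extend I).symm (G.symm (p.1, ψ.extend J p.2)).2.1)
    with hL
  have hUo : IsOpen U := by
    have hc : ContinuousOn (fun p : ℝ × N => (p.1, ψ.extend J p.2)) ((univ : Set ℝ) ×ˢ ψ.source) :=
      continuousOn_fst.prodMk ((ψ.continuousOn_extend.mono (by rw [ψ.extend_source])).comp
        continuousOn_snd fun p hp => hp.2)
    have h := hc.isOpen_inter_preimage (isOpen_univ.prod ψ.open_source) G.open_target
    convert h using 1
    ext p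
    simp only [hU, mem_setOf_eq, mem_inter_iff, mem_prod, mem_univ, true_and, mem_preimage]
  refine ⟨U, hUo, ?_, L, ?_, ?_⟩
  · -- the base point lies in `U`
    refine ⟨hyψ, ?_⟩
    have h := G.map_source haG
    rwa [hGK, hKslice t₀ x₀ hxφ] at h
  · -- `L` is smooth on `U`
    have h1 : ContMDiffOn (𝓘(ℝ, ℝ).prod J) 𝓘(ℝ, ℝ × EN) ∞
        (fun p : ℝ × N => ((p.1, ψ.extend J p.2) : ℝ × EN)) U := by
      refine contMDiffOn_fst.prodMk_space ?_
      exact (ψ.contMDiffOn_extend hψ).comp contMDiffOn_snd fun p hp => hp.1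
    have h2 : ContMDiffOn (𝓘(ℝ, ℝ).prod J) 𝓘(ℝ, ℝ × (EM × himm.complement)) ∞
        (fun p : ℝ × N => G.symm (p.1, ψ.extend J p.2)) U :=
      hGsymm.contMDiffOn.comp h1 fun p hp => hp.2
    have h3 : ContMDiffOn 𝓘(ℝ, ℝ × (EM × himm.complement)) (𝓘(ℝ, ℝ).prod I) ∞
        (fun r : ℝ × (EM × himm.complement) => ((r.1, (φ.extend I).symm r.2.1) : ℝ × M))
        {r | r.2.1 ∈ (φ.extend I).target} := by
      refine contDiff_fst.contMDiff.contMDiffOn.prodMk ?_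
      refine (contMDiffOn_extend_symm hφ).comp
        (contDiff_fst.comp contDiff_snd).contMDiff.contMDiffOn fun r hr => ?_
      rw [← φ.extend_target']
      exact hr
    refine (h3.comp h2 fun p hp => ?_).congr fun p _ => rfl
    have hs : G.symm (p.1, ψ.extend J p.2) ∈ G.source := G.map_target hp.2
    have hs' : (G.symm (p.1, ψ.extend J p.2)).2.1 ∈ interior (φ.extend I).target := (hGsrc hs).1
    show (G.symm (p.1, ψ.extend J p.2)).2.1 ∈ (φ.extend I).target
    exact interior_subset hs'
  · -- the neighbourhood `W` and the left-inverse property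
    set W : Set (ℝ × M) :=
      {q | q.2 ∈ φ.source ∧ (q.1, (φ.extend I q.2, (0 : himm.complement))) ∈ G.source} with hW
    have hWo : IsOpen W := by
      have hc : ContinuousOn
          (fun q : ℝ × M => ((q.1, (φ.extend I q.2, (0 : himm.complement))) :
            ℝ × (EM × himm.complement))) ((univ : Set ℝ) ×ˢ φ.source) :=
        continuousOn_fst.prodMk (((φ.continuousOn_extend.mono (by rw [φ.extend_source])).comp
          continuousOn_snd fun q hq => hq.2).prodMk continuousOn_const)
      have h := hc.isOpen_inter_preimage (isOpen_univ.prod φ.open_source) G.open_source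
      convert h using 1
      ext q
      simp only [hW, mem_setOf_eq, mem_inter_iff, mem_prod, mem_univ, true_and, mem_preimage]
    refine ⟨W, hWo, ⟨hxφ, haG⟩, fun q hq => ?_, fun q hq => ?_⟩
    · -- the track of `W` lies in `U`
      obtain ⟨s, x⟩ := q
      obtain ⟨hx, hG⟩ := hq
      have hsrc := hGsrc hG
      refine ⟨?_, ?_⟩
      · have h2 := hsrc.2
        simp only at h2
        rwa [φ.extend_left_inv hx] at h2
      · have h := G.map_source hG
        rwa [hGK, hKslice s x hx] at h
    · -- `L ∘ track = id` on `W`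
      obtain ⟨s, x⟩ := q
      obtain ⟨hx, hG⟩ := hq
      have hinv : G.symm (s, ψ.extend J (F.toFun s x)) = (s, (φ.extend I x, 0)) := by
        rw [← hKslice s x hx, ← hGK]
        exact G.left_inv hG
      simp only [hL, hinv, φ.extend_left_inv hx]

end SmoothIsotopy

end Literature.Topology.FourManifolds
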